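import Literature.AlgebraicTopology.Homotopy.LatticeFaceLCFill
import Literature.Topology.Euclidean.LatticeCubeSkeleton
import HarnessLib

/-!
# Relative skeletal extension into a locally contractible compactum over one cube shell

Topic `Literature/AlgebraicTopology/Homotopy`. The inductive core of Hatcher's proof that a
compact locally contractible `K ⊆ ℝᴺ` is a neighbourhood retract (*Algebraic Topology* (2002),
Thm. A.7, p. 527: vertices go to nearest points of `K`; a cell whose boundary is already mapped
is filled using local contractibility, keeping images small), organised shell by shell: given a
finite lattice cube complex `Q = complex 𝒬 h` (one dyadic shell around `K`), a second complex
`P = complex 𝒬' h` of the same mesh (the previous, coarser shell, subdivided) carrying a map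
`g₀ : P → K`, and a modulus of uniform local contractibility `μ` of `K`
(`UniformLocalContractibility.lean`), we build `g : Q → K`, continuous, equal to `g₀` on `Q ∩ P`,
moving points by at most an explicit amount `T N` — and by at most `S N` on the closed faces of
`Q` not meeting `P` — where `S`, `T` are computed from the mesh, the distance of `Q` to `K`, the
displacement of `g₀`, and `μ` (`ShellHyp`, `S`, `T`).

* `ShellHyp`: the data and hypotheses; `ShellHyp.S`, `ShellHyp.T`: the displacement recursions;
* `ShellStage k`: the stage-`k` invariant (map on the `k`-skeleton);
* `shellStage_zero`, `shellStage_succ`, `ShellHyp.exists_extension` (**the theorem**).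

No `sorry`; [folklore] packaging of Hatcher's argument.

## References

* A. Hatcher, *Algebraic Topology*, CUP (2002), Appendix, Thm. A.7 and its proof (p. 527).
  [HatcherAT2002]
-/

noncomputable section

open Set Metric Topology Filter Function
open Literature.Topology.Euclidean Literature.Topology.Euclidean.LatticeCube

namespace Literature.AlgebraicTopology.Homotopy

namespace ShellExtension

variable {N : ℕ}

/-- **The data of one shell**: mesh `h > 0`, the shell cubes `𝒬`, the previous-shell cubes
`𝒬'` (same mesh), the compactum `K` (nonempty), the previous map `g₀`, the modulus `μ` valid
below `ρ₀`, the distance bound `dK` of the shell to `K` and the displacement bound `T₀` of `g₀`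
on `Q ∩ P`. [folklore] -/
structure ShellHyp (N : ℕ) where
  /-- mesh -/
  h : ℝ
  /-- the cubes of the shell -/
  𝒬 : Finset (Fin N → ℤ)
  /-- the cubes of the previous shell (subdivided to the same mesh) -/
  𝒬' : Finset (Fin N → ℤ)
  /-- the compactum -/
  K : Set (Fin N → ℝ)
  /-- the map on the previous shell -/
  g₀ : (Fin N → ℝ) → (Fin N → ℝ)
  /-- modulus of uniform local contractibility -/
  μ : ℝ → ℝ
  /-- validity threshold of the modulus -/
  ρ₀ : ℝ
  /-- distance from the shell to `K` -/
  dK : ℝ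
  /-- displacement of `g₀` -/
  T₀ : ℝ
  hh : 0 < h
  hK : IsCompact K
  hKne : K.Nonempty
  hg₀c : ContinuousOn g₀ (complex 𝒬' h)
  hg₀K : MapsTo g₀ (complex 𝒬' h) K
  hμ : ∀ ρ, 0 < ρ → ρ < ρ₀ → UniformlyLC K ρ (μ ρ)
  hμge : ∀ ρ, ρ ≤ μ ρ
  hdK0 : 0 ≤ dK
  hdK : ∀ x ∈ complex 𝒬 h, infDist x K ≤ dK
  hT₀0 : 0 ≤ T₀
  hT₀ : ∀ x ∈ complex 𝒬 h ∩ complex 𝒬' h, dist (g₀ x) x ≤ T₀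

variable (X : ShellHyp N)

/-- The displacement bound on faces not meeting the previous shell, by dimension. [folklore] -/
def ShellHyp.S : ℕ → ℝ
  | 0 => X.dK
  | k + 1 => X.μ (2 * ShellHyp.S k + X.h) + ShellHyp.S k + X.h

/-- The displacement bound on all faces, by dimension (kept `≥ S`). [folklore] -/
def ShellHyp.T : ℕ → ℝ
  | 0 => max X.T₀ X.dK
  | k + 1 => max (X.μ (2 * ShellHyp.T k + X.h) + ShellHyp.T k + X.h) (X.S (k + 1))

/-- The previous shell `P = complex 𝒬' h`. [folklore] -/
def ShellHyp.P : Set (Fin N → ℝ) := complex X.𝒬' X.h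

/-- The prescribed faces: the faces lying in the previous shell. [folklore] -/
def ShellHyp.D : Set (Face N) := {F | F.carrier X.h ⊆ X.P}

/-- `S ≥ 0`. [folklore] -/
theorem ShellHyp.S_nonneg : ∀ k, 0 ≤ X.S k
  | 0 => X.hdK0
  | k + 1 => by
    have := ShellHyp.S_nonneg k
    have h2 := X.hμge (2 * X.S k + X.h)
    show 0 ≤ X.μ (2 * X.S k + X.h) + X.S k + X.h
    linarith [X.hh.le]

/-- `S ≤ T`. [folklore] -/
theorem ShellHyp.S_le_T : ∀ k, X.S k ≤ X.T k
  | 0 => le_max_right _ _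
  | _ + 1 => le_max_right _ _

/-- `T ≥ 0`. [folklore] -/
theorem ShellHyp.T_nonneg (k : ℕ) : 0 ≤ X.T k := (X.S_nonneg k).trans (X.S_le_T k)

/-- The defining inequality of `T (k + 1)`. [folklore] -/
theorem ShellHyp.T_succ_ge (k : ℕ) : X.μ (2 * X.T k + X.h) + X.T k + X.h ≤ X.T (k + 1) :=
  le_max_left _ _

/-- `S` is monotone (one step). [folklore] -/
theorem ShellHyp.S_le_succ (k : ℕ) : X.S k ≤ X.S (k + 1) := by
  have h2 := X.hμge (2 * X.S k + X.h)
  show X.S k ≤ X.μ (2 * X.S k + X.h) + X.S k + X.h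
  linarith [X.hh.le, X.S_nonneg k]

/-- `T` is monotone (one step). [folklore] -/
theorem ShellHyp.T_le_succ (k : ℕ) : X.T k ≤ X.T (k + 1) := by
  have h2 := X.hμge (2 * X.T k + X.h)
  have h3 := X.T_succ_ge k
  linarith [X.hh.le, X.T_nonneg k]

/-- `S` is monotone. [folklore] -/
theorem ShellHyp.S_mono {k k' : ℕ} (hk : k ≤ k') : X.S k ≤ X.S k' := by
  induction hk with
  | refl => exact le_rfl
  | step _ ih => exact ih.trans (X.S_le_succ _)

/-- `T` is monotone. [folklore] -/
theorem ShellHyp.T_mono {k k' : ℕ} (hk : k ≤ k') : X.T k ≤ X.T k' := by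
  induction hk with
  | refl => exact le_rfl
  | step _ ih => exact ih.trans (X.T_le_succ _)

/-- `T₀ ≤ T k`. [folklore] -/
theorem ShellHyp.T₀_le_T (k : ℕ) : X.T₀ ≤ X.T k :=
  (le_max_left _ _).trans (X.T_mono (Nat.zero_le k))

/-- **Stage `k`**: a map on the `k`-skeleton of the shell, into `K`, prescribed on prescribed
faces, with the two displacement bounds. [folklore] -/
structure ShellStage (k : ℕ) where
  /-- the map -/
  g : (Fin N → ℝ) → (Fin N → ℝ)
  cont : ContinuousOn g (skel X.𝒬 X.h k)
  mapsK : MapsTo g (skel X.𝒬 X.h k) X.K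
  presc : ∀ F ∈ faces X.𝒬, F.S.card ≤ k → F ∈ X.D → EqOn g X.g₀ (F.carrier X.h)
  dispT : ∀ F ∈ faces X.𝒬, F.S.card ≤ k → ∀ x ∈ F.carrier X.h, dist (g x) x ≤ X.T k
  dispS : ∀ F ∈ faces X.𝒬, F.S.card ≤ k → Disjoint (F.carrier X.h) X.P →
    ∀ x ∈ F.carrier X.h, dist (g x) x ≤ X.S k

variable {X}

/-! ### Stage `0`: nearest points -/

/-- **Stage `0`** (Hatcher: "let `r` send each `0`-cell to the closest point of `K`"; prescribed
vertices keep their value). [cite: HatcherAT2002, Thm. A.7 (proof)] -/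
theorem shellStage_zero : Nonempty (ShellStage X 0) := by
  classical
  have hh := X.hh
  -- nearest points
  have hnp : ∀ x : Fin N → ℝ, ∃ y ∈ X.K, infDist x X.K = dist x y :=
    fun x => X.hK.exists_infDist_eq_dist X.hKne x
  choose np hnpK hnpd using hnp
  let g : (Fin N → ℝ) → (Fin N → ℝ) := fun x => if x ∈ X.P then X.g₀ x else np x
  have hfin : (skel X.𝒬 X.h 0).Finite := by
    refine ((faces_finite X.𝒬).image fun F => F.cornerPoint X.h).subset fun x hx => ?_
    obtain ⟨F, hF, hF0, hxF⟩ := mem_skel.1 hx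
    rw [Face.carrier_eq_singleton_of_S_eq_empty (G := F) (h := X.h)
      (Finset.card_eq_zero.1 (Nat.le_zero.1 hF0)), mem_singleton_iff] at hxF
    exact ⟨F, hF, hxF.symm⟩
  refine ⟨⟨g, hfin.continuousOn _, fun x hx => ?_, ?_, ?_, ?_⟩⟩
  · by_cases hxP : x ∈ X.P
    · simp only [g, hxP, if_true]; exact X.hg₀K hxP
    · simp only [g, hxP, if_false]; exact hnpK x
  · intro F hF hF0 hFD x hx
    have hxP : x ∈ X.P := hFD hx
    simp only [g, hxP, if_true]
  · intro F hF hF0 x hx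
    have hxQ : x ∈ complex X.𝒬 X.h := carrier_subset_complex hh.le hF hx
    by_cases hxP : x ∈ X.P
    · simp only [g, hxP, if_true]
      exact (X.hT₀ x ⟨hxQ, hxP⟩).trans (le_max_left _ _)
    · simp only [g, hxP, if_false]
      rw [dist_comm, ← hnpd x]
      exact (X.hdK x hxQ).trans (le_max_right _ _)
  · intro F hF hF0 hFP x hx
    have hxQ : x ∈ complex X.𝒬 X.h := carrier_subset_complex hh.le hF hx
    have hxP : x ∉ X.P := fun h' => hFP.ne_of_mem hx h' rfl
    simp only [g, hxP, if_false]
    rw [dist_comm, ← hnpd x]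
    exact X.hdK x hxQ

/-! ### Stage `k + 1` from stage `k` -/

/-- Faces of prescribed faces are prescribed. [folklore] -/
theorem mem_D_of_isFaceOf' {F G : Face N} (hGF : G.carrier X.h ⊆ F.carrier X.h) (hF : F ∈ X.D) :
    G ∈ X.D := fun _ hx => hF (hGF hx)

/-- **The extension over one face**: prescribed faces take `g₀`; the others are filled from
their boundary along a contraction of `K` (`exists_lcFill`) around the image of a boundary
point, with the radius `2 T k + h` (or `2 S k + h` for faces not meeting `P`).
[cite: HatcherAT2002, Thm. A.7 (proof)] -/
theorem face_step {k : ℕ} (A : ShellStage X k) (hsmall : 2 * X.T k + X.h < X.ρ₀) {F : Face N}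
    (hF : F ∈ faces X.𝒬) (hFk : F.S.card = k + 1) :
    ∃ Φ : (Fin N → ℝ) → (Fin N → ℝ), ContinuousOn Φ (F.carrier X.h) ∧
      EqOn Φ A.g (F.carrier X.h \ F.relint X.h) ∧ MapsTo Φ (F.carrier X.h) X.K ∧
      (F ∈ X.D → EqOn Φ X.g₀ (F.carrier X.h)) ∧
      (∀ x ∈ F.carrier X.h, dist (Φ x) x ≤ X.T (k + 1)) ∧
      (Disjoint (F.carrier X.h) X.P → ∀ x ∈ F.carrier X.h, dist (Φ x) x ≤ X.S (k + 1)) := by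
  classical
  have hh := X.hh
  -- the boundary lies in the `k`-skeleton, in boundary faces of dimension `k`
  have hbd : ∀ x ∈ F.carrier X.h \ F.relint X.h, ∃ G ∈ faces X.𝒬, G.S.card = k ∧
      G.carrier X.h ⊆ F.carrier X.h ∧ x ∈ G.carrier X.h := by
    rintro x ⟨hx, hx'⟩
    obtain ⟨i₀, hi₀, up, hmem⟩ := F.exists_mem_carrier_bdFace hx hx'
    exact ⟨F.bdFace i₀ up, bdFace_mem_faces hF hi₀ up, by rw [Face.card_bdFace_S hi₀, hFk]; rfl,
      F.carrier_bdFace_subset hh.le hi₀ up, hmem⟩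
  have hbd_skel : F.carrier X.h \ F.relint X.h ⊆ skel X.𝒬 X.h k := fun x hx => by
    obtain ⟨G, hG, hGk, -, hxG⟩ := hbd x hx
    exact carrier_subset_skel hG hGk.le hxG
  by_cases hFD : F ∈ X.D
  · -- prescribed face: `g₀`
    have hFP : F.carrier X.h ⊆ X.P := hFD
    refine ⟨X.g₀, X.hg₀c.mono hFP, fun x hx => ?_, fun x hx => X.hg₀K (hFP hx),
      fun _ => eqOn_refl _ _, fun x hx => ?_, fun hdis => ?_⟩
    · obtain ⟨G, hG, hGk, hGF, hxG⟩ := hbd x hx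
      exact (A.presc G hG hGk.le (mem_D_of_isFaceOf' hGF hFD) hxG).symm
    · have hxQ : x ∈ complex X.𝒬 X.h := carrier_subset_complex hh.le hF hx
      exact (X.hT₀ x ⟨hxQ, hFP hx⟩).trans (X.T₀_le_T _)
    · -- a prescribed face meets `P` (it is nonempty)
      exfalso
      have hne : (F.carrier X.h).Nonempty := ⟨_, Face.cornerPoint_mem_carrier (G := F) hh.le⟩
      obtain ⟨x, hx⟩ := hne
      exact hdis.ne_of_mem hx (hFP hx) rfl
  · -- non-prescribed face: fill along a contraction
    -- the radius: `2 B + h` with `B = S k` if `F` misses `P`, else `T k`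
    let B : ℝ := if Disjoint (F.carrier X.h) X.P then X.S k else X.T k
    have hBdisp : ∀ x ∈ F.carrier X.h \ F.relint X.h, dist (A.g x) x ≤ B := by
      intro x hx
      obtain ⟨G, hG, hGk, hGF, hxG⟩ := hbd x hx
      by_cases hdis : Disjoint (F.carrier X.h) X.P
      · simp only [B, hdis, if_true]
        exact A.dispS G hG hGk.le (hdis.mono_left hGF) x hxG
      · simp only [B, hdis, if_false]
        exact A.dispT G hG hGk.le x hxG
    have hBT : B ≤ X.T k := by
      by_cases hdis : Disjoint (F.carrier X.h) X.P
      · simp only [B, hdis, if_true]; exact X.S_le_T k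
      · simp only [B, hdis, if_false]; exact le_rfl
    have hB0 : 0 ≤ B := by
      by_cases hdis : Disjoint (F.carrier X.h) X.P
      · simp only [B, hdis, if_true]; exact X.S_nonneg k
      · simp only [B, hdis, if_false]; exact X.T_nonneg k
    -- a boundary point: the corner (not in the open face since `dim F ≥ 1`)
    set x₀ : Fin N → ℝ := F.cornerPoint X.h with hx₀
    have hx₀F : x₀ ∈ F.carrier X.h := Face.cornerPoint_mem_carrier (G := F) hh.le
    have hx₀bd : x₀ ∈ F.carrier X.h \ F.relint X.h := by
      refine ⟨hx₀F, fun hr => ?_⟩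
      have hSne : F.S.Nonempty := Finset.card_pos.1 (by rw [hFk]; exact Nat.succ_pos k)
      obtain ⟨i, hi⟩ := hSne
      have := ((hr i).1 hi).1
      simp [hx₀, Face.cornerPoint] at this
    set a : Fin N → ℝ := A.g x₀ with ha
    have haK : a ∈ X.K := A.mapsK (hbd_skel hx₀bd)
    -- the contraction at radius `δ = 2 B + h`
    set δ : ℝ := 2 * B + X.h with hδ
    have hδ0 : 0 < δ := by rw [hδ]; linarith
    have hδρ : δ < X.ρ₀ := by rw [hδ]; linarith
    obtain ⟨BC⟩ := X.hμ δ hδ0 hδρ a haK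
    -- boundary data
    have hbc : ContinuousOn A.g (F.carrier X.h \ F.relint X.h) := A.cont.mono hbd_skel
    have hbK : MapsTo A.g (F.carrier X.h \ F.relint X.h) (X.K ∩ closedBall a δ) := by
      intro x hx
      refine ⟨A.mapsK (hbd_skel hx), mem_closedBall.2 ?_⟩
      calc dist (A.g x) a ≤ dist (A.g x) x + dist x x₀ + dist x₀ (A.g x₀) := dist_triangle4 _ _ _ _
        _ ≤ B + X.h + B := by
          refine add_le_add (add_le_add (hBdisp x hx) ?_) ?_
          · exact Face.dist_le_of_mem_carrier (G := F) hh.le hx.1 hx₀F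
          · rw [dist_comm]; exact hBdisp x₀ hx₀bd
        _ = δ := by rw [hδ]; ring
    obtain ⟨Φ, hΦc, hΦeq, hΦmem⟩ := exists_lcFill hh F hFk (Nat.succ_pos k) BC hbc hbK
    -- displacement of the fill
    have hdisp : ∀ x ∈ F.carrier X.h, dist (Φ x) x ≤ X.μ (2 * B + X.h) + B + X.h := by
      intro x hx
      have h1 : dist (Φ x) a < X.μ δ := mem_ball.1 (hΦmem hx).2
      calc dist (Φ x) x ≤ dist (Φ x) a + dist a x₀ + dist x₀ x := dist_triangle4 _ _ _ _
        _ ≤ X.μ (2 * B + X.h) + B + X.h := by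
          refine add_le_add (add_le_add (by rw [← hδ]; exact h1.le) ?_) ?_
          · rw [ha]; exact hBdisp x₀ hx₀bd
          · exact Face.dist_le_of_mem_carrier (G := F) hh.le hx₀F hx
    refine ⟨Φ, hΦc, hΦeq, fun x hx => (hΦmem hx).1, fun hD => absurd hD hFD, fun x hx => ?_,
      fun hdis x hx => ?_⟩
    · refine (hdisp x hx).trans ?_
      by_cases hdis : Disjoint (F.carrier X.h) X.P
      · simp only [B, hdis, if_true]
        exact (le_max_right _ _ : X.S (k + 1) ≤ X.T (k + 1))
      · simp only [B, hdis, if_false]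
        exact X.T_succ_ge k
    · refine (hdisp x hx).trans ?_
      simp only [B, hdis, if_true]
      exact le_rfl

/-- A point of a closed `(k + 1)`-face of the complex off the `k`-skeleton lies in the open face. [folklore] -/
theorem mem_relint_of_not_mem_skel' {k : ℕ} {F : Face N} (hF : F ∈ faces X.𝒬)
    (hFk : F.S.card = k + 1) {x : Fin N → ℝ} (hx : x ∈ F.carrier X.h)
    (hxn : x ∉ skel X.𝒬 X.h k) : x ∈ F.relint X.h := by
  by_contra hx'
  exact hxn (Face.mem_skel_of_mem_carrier_diff_relint hF hFk.le hx hx')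

/-- **Stage `k + 1` from stage `k`**: glue the face extensions of `face_step`.
[cite: HatcherAT2002, Thm. A.7 (proof)] -/
theorem shellStage_succ {k : ℕ} (A : ShellStage X k) (hsmall : 2 * X.T k + X.h < X.ρ₀) :
    Nonempty (ShellStage X (k + 1)) := by
  classical
  have hh := X.hh
  set 𝓕 : Set (Face N) := {F | F ∈ faces X.𝒬 ∧ F.S.card = k + 1} with h𝓕
  have h𝓕f : 𝓕.Finite := (faces_finite X.𝒬).subset fun F hF => hF.1
  haveI : Finite 𝓕 := h𝓕f.to_subtype
  have hex := fun F : 𝓕 => face_step A hsmall F.2.1 F.2.2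
  choose Φ hΦc hΦbd hΦK hΦD hΦT hΦS using hex
  -- the glued map
  let g' : (Fin N → ℝ) → (Fin N → ℝ) := fun x =>
    if x ∈ skel X.𝒬 X.h k then A.g x
    else if hx : ∃ F : 𝓕, x ∈ F.1.relint X.h then Φ hx.choose x else A.g x
  have hg'_skel : ∀ x ∈ skel X.𝒬 X.h k, g' x = A.g x := fun x hx => by simp [g', hx]
  have hg'_face : ∀ (F : 𝓕), ∀ x ∈ F.1.carrier X.h, g' x = Φ F x := by
    intro F x hx
    by_cases hxn : x ∈ skel X.𝒬 X.h k
    · have hx' : x ∉ F.1.relint X.h := fun hr =>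
        Face.not_mem_skel_of_mem_relint hh (by rw [F.2.2]; omega) hr hxn
      rw [hg'_skel x hxn, hΦbd F ⟨hx, hx'⟩]
    · have hxr : x ∈ F.1.relint X.h := mem_relint_of_not_mem_skel' F.2.1 F.2.2 hx hxn
      have hex' : ∃ F' : 𝓕, x ∈ F'.1.relint X.h := ⟨F, hxr⟩
      have hF' : hex'.choose = F := by
        apply Subtype.ext
        exact (Face.eq_of_mem_relint_of_mem_carrier hh hex'.choose_spec hx
          (by rw [F.2.2, hex'.choose.2.2])).symm
      simp only [g', hxn, if_false, dif_pos hex']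
      rw [hF']
  -- continuity on the `(k + 1)`-skeleton
  have hcont : ContinuousOn g' (skel X.𝒬 X.h (k + 1)) := by
    have hcov : skel X.𝒬 X.h (k + 1) ⊆
        ⋃ o : Option 𝓕, Option.elim o (skel X.𝒬 X.h k) fun F => F.1.carrier X.h := by
      intro x hx
      obtain ⟨F, hF, hFk, hxF⟩ := mem_skel.1 hx
      rcases hFk.lt_or_eq with hlt | heq
      · exact mem_iUnion.2 ⟨none, mem_skel.2 ⟨F, hF, by omega, hxF⟩⟩
      · exact mem_iUnion.2 ⟨some ⟨F, hF, heq⟩, hxF⟩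
    refine ContinuousOn.mono ?_ hcov
    refine (locallyFinite_of_finite _).continuousOn_iUnion (fun o => ?_) fun o => ?_
    · cases o with
      | none => exact isClosed_skel k
      | some F => exact F.1.isClosed_carrier X.h
    · cases o with
      | none => exact A.cont.congr fun x hx => hg'_skel x hx
      | some F => exact (hΦc F).congr fun x hx => hg'_face F x hx
  refine ⟨⟨g', hcont, ?_, ?_, ?_, ?_⟩⟩
  · -- into `K`
    intro x hx
    obtain ⟨F, hF, hFk, hxF⟩ := mem_skel.1 hx
    rcases hFk.lt_or_eq with hlt | heq
    · rw [hg'_skel x (mem_skel.2 ⟨F, hF, by omega, hxF⟩)]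
      exact A.mapsK (mem_skel.2 ⟨F, hF, by omega, hxF⟩)
    · rw [hg'_face ⟨F, hF, heq⟩ x hxF]
      exact hΦK ⟨F, hF, heq⟩ hxF
  · -- prescribed faces
    intro F hF hFk hFD x hx
    rcases hFk.lt_or_eq with hlt | heq
    · rw [hg'_skel x (carrier_subset_skel hF (by omega) hx)]
      exact A.presc F hF (by omega) hFD hx
    · rw [hg'_face ⟨F, hF, heq⟩ x hx]
      exact hΦD ⟨F, hF, heq⟩ hFD hx
  · -- displacement, all faces
    intro F hF hFk x hx
    rcases hFk.lt_or_eq with hlt | heq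
    · rw [hg'_skel x (carrier_subset_skel hF (by omega) hx)]
      exact (A.dispT F hF (by omega) x hx).trans (X.T_le_succ k)
    · rw [hg'_face ⟨F, hF, heq⟩ x hx]
      exact hΦT ⟨F, hF, heq⟩ x hx
  · -- displacement, faces missing `P`
    intro F hF hFk hdis x hx
    rcases hFk.lt_or_eq with hlt | heq
    · rw [hg'_skel x (carrier_subset_skel hF (by omega) hx)]
      exact (A.dispS F hF (by omega) hdis x hx).trans (X.S_le_succ k)
    · rw [hg'_face ⟨F, hF, heq⟩ x hx]
      exact hΦS ⟨F, hF, heq⟩ hdis x hx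

/-- All stages up to `n ≤ N`, under the smallness of the radii used. [folklore] -/
theorem shellStage_all (hsmall : ∀ k, k < N → 2 * X.T k + X.h < X.ρ₀) :
    ∀ n, n ≤ N → Nonempty (ShellStage X n) := by
  intro n
  induction n with
  | zero => exact fun _ => shellStage_zero
  | succ n ih =>
    intro hn
    obtain ⟨A⟩ := ih (by omega)
    exact shellStage_succ A (hsmall n (by omega))

/-- **Relative skeletal extension over one shell** (Hatcher's proof of Thm. A.7, one dyadic
layer): under `ShellHyp` and the smallness `2 T k + h < ρ₀` (`k < N`) of the radii used, there
is `g`, continuous on the shell `Q = complex 𝒬 h`, with values in `K`, equal to `g₀` on `Q ∩ P`,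
displacing points by `≤ T N`, and by `≤ S N` on the closed faces of `Q` not meeting `P`.
[cite: HatcherAT2002, Thm. A.7 (proof)] -/
theorem ShellHyp.exists_extension (X : ShellHyp N)
    (hsmall : ∀ k, k < N → 2 * X.T k + X.h < X.ρ₀) :
    ∃ g : (Fin N → ℝ) → (Fin N → ℝ), ContinuousOn g (complex X.𝒬 X.h) ∧
      MapsTo g (complex X.𝒬 X.h) X.K ∧ EqOn g X.g₀ (complex X.𝒬 X.h ∩ X.P) ∧
      (∀ x ∈ complex X.𝒬 X.h, dist (g x) x ≤ X.T N) ∧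
      (∀ F ∈ faces X.𝒬, Disjoint (F.carrier X.h) X.P → ∀ x ∈ F.carrier X.h,
        dist (g x) x ≤ X.S N) := by
  have hh := X.hh
  obtain ⟨A⟩ := shellStage_all hsmall N le_rfl
  have hskel : skel X.𝒬 X.h N = complex X.𝒬 X.h := skel_eq_complex hh.le le_rfl
  refine ⟨A.g, hskel ▸ A.cont, hskel ▸ A.mapsK, fun x hx => ?_, fun x hx => ?_,
    fun F hF hdis x hx => A.dispS F hF (card_S_le F) hdis x hx⟩
  · -- `x ∈ Q ∩ P` lies in the open part of a face of `Q` contained in `P`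
    obtain ⟨F, hF, hxF⟩ := exists_mem_relint_of_mem_complex hx.1
    obtain ⟨b, hb, hxb⟩ := mem_complex.1 hx.2
    have hFb : F.IsFaceOf b := Face.isFaceOf_of_mem_relint_of_mem_top hh hxF hxb
    have hFD : F ∈ X.D := fun y hy =>
      mem_complex.2 ⟨b, hb, F.carrier_subset_carrier_top hh.le hFb hy⟩
    exact A.presc F hF (card_S_le F) hFD (Face.relint_subset_carrier hxF)
  · obtain ⟨F, hF, hxF⟩ := exists_mem_relint_of_mem_complex hx
    exact A.dispT F hF (card_S_le F) x (Face.relint_subset_carrier hxF)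

end ShellExtension

end Literature.AlgebraicTopology.Homotopy

end
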